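import Summits.ResolutionOfSingularities.ResolutionOfSingularities.Theses.WildQuotients
import Summits.ResolutionOfSingularities.ResolutionOfSingularities.Theorems.PAlterationAssembly
import Summits.ResolutionOfSingularities.ResolutionOfSingularities.Theorems.PAlterationPalterationThesisPialtOfPerfect
import Summits.ResolutionOfSingularities.ResolutionOfSingularities.Theorems.PAlterationPialtNormalProjective
import Summits.ResolutionOfSingularities.ResolutionOfSingularities.Theorems.WildQuotientsGaloisQuotientAlteration
import HarnessLib

/-!
# `WildQuotients.SummitReduction` (stmt-ResolutionOfSingularities-16324): the PERFECT SQUEEZE —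
# de Jong's Galois alteration is needed only for normal projective varieties over perfect fields

Route `ResolutionOfSingularities/WildQuotients`, crux `SummitReduction`
(`∀ p prime, WQ_p → PICover_p → ResolutionInChar p`). The crux is closed in tree modulo the named
fact `Literature.AlgebraicGeometry.Resolution.DeJong1997_galoisAlterationQuasiProjective` (de
Jong 1997, Thm. 5.13 / Cor. 5.15, over EVERY field and for EVERY integral separated finite-type
`X`): `Theorems.summitReduction_of_deJong1997` (`…WildQuotientsSummitReductionOfDeJong1997`).

This file (line `FramePerfect` of the crux, card `perfect-squeeze` + ideator-2 frame) proves the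
SQUEEZED conditional: it suffices to have de Jong's Galois alteration for NORMAL PROJECTIVE
integral varieties over PERFECT fields of characteristic `p`
(`summitReduction_of_forall_perfectField_galoisAlteration`, per prime
`resolutionInChar_of_galoisAlterationPerfectAt`). Ingredients:

1. FRAME (tree, proved): `PalterationThesis.PerfectTransfer.stub_pialtOfPerfect` (purely
   inseparable regular alterations descend from the perfect closure to `k`),
   `pialtConclusion_of_forall_normal_isProjectiveOver` (Chow's lemma + normalisation: PIAlt for
   normal projective varieties suffices), `hasResolution_of_thesis` (pAlteration's Theorem B,
   every field) and `Theses.PAlteration.DescentReducedToIntegral_holds` (reduced → integral) ⇒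
   `resolutionInChar_of_pialtPerfectNormalProjectiveAt_of_picoverAt`;
2. COMPOSITION (de Jong 1996, 2.20): a Galois-type quotient presentation `q : X' → X₁ = X'/G`,
   `φ : X₁ → X` finite radicial over a dense open, plus `WQ_p`, gives PIAlt for `X`
   (`pialtPerfectNormalProjectiveAt_of_galoisQuotientAlterationAt`);
3. QUOTIENT (SGA 1, V §1–2; Mumford AV §7; all proved in tree:
   `…RelativeSpec.FiniteGroupQuotient{Gluing,GluedProperties,GenericEtale}`,
   `…Theorems.WildQuotientsGaloisQuotientAlteration{,Radicial}`): the per-`(k, X)` form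
   `galoisQuotientAlterationAt_of_deJong` of `galoisQuotientAlteration_of_deJong1997` (proof
   adapted from that theorem with the de Jong hypothesis localised at `(k, X)`).

Why the squeeze matters: the hypothesis (pAlteration's `hPI`) is consumed by the frame only over
perfect fields (at `PerfectClosure k p`), and only for normal projective varieties (Chow +
normalisation), so a future discharge of de Jong's theorem for this crux may work in de Jong's
1996 §7 setting (perfect ground field, projective `X`) — no Galois descent from `k̄` and no
equivariant Chow lemma are needed. Everything here is proved; the file is CONDITIONAL only through
the explicit hypothesis of its last two theorems (no named fact is imported as an axiom).
-/

set_option linter.dupNamespace false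

noncomputable section

open CategoryTheory CategoryTheory.Limits AlgebraicGeometry TopologicalSpace
open Literature.AlgebraicGeometry.Resolution Literature.AlgebraicGeometry.RelativeSpec
open Literature.AlgebraicGeometry.Motives (RatFn.functionFieldMap RatFn.functionFieldMap_comp)
open Literature.AlgebraicGeometry

namespace Summit.ResolutionOfSingularities.ResolutionOfSingularities.Theorems

/-! ## Glue 1: the Galois-type quotient presentation from de Jong's Galois alteration -/

/-- The characteristic of the function field of a variety over a field of characteristic `p`.
[folklore] -/
theorem charP_functionField_of_over {p : ℕ} {k : Type} [Field k] [CharP k p] {X : Scheme.{0}}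
    [IsIntegral X] (f : X ⟶ Spec (.of k)) : CharP X.functionField p := by
  let ι : k →+* X.functionField :=
    (X.presheaf.germ ⊤ (genericPoint X) trivial).hom.comp
      (f.appTop.hom.comp (Scheme.ΓSpecIso (.of k)).inv.hom)
  exact (ι.charP_iff_charP p).mp ‹_›

/-- **The Galois-type quotient presentation** (de Jong 1997 Thm. 5.13 / Cor. 5.15 + SGA 1 V.1 +
Abramovich–Oort 2000 Cor. 2.9), at a field `k` of characteristic `p`, from de Jong's Galois
alteration with regular quasi-projective source and faithful group at `k`: the body of the support
`WildQuotients.GaloisQuotientAlteration` at `(p, k, X)`. [cite: DeJong1997, Cor. 5.15]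
[cite: AbramovichOort2000, Cor. 2.9] -/
theorem galoisQuotientAlterationAt_of_deJong {p : ℕ} (hp : p.Prime) {k : Type} [Field k]
    [CharP k p] (X : Scheme.{0}) (f : X ⟶ Spec (.of k)) [IsSeparated f] [LocallyOfFiniteType f]
    [QuasiCompact f] [IsIntegral X]
    (hdJ : ∃ (G : Type) (_ : Group G) (_ : Finite G) (X₁ : Scheme.{0}) (_ : IsIntegral X₁)
      (ρ : G →* Aut X₁) (π : X₁ ⟶ X) (_ : IsDominant π),
      IsAlteration π ∧ Scheme.IsRegular X₁ ∧ Function.Injective ρ ∧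
      (∀ g : G, (ρ g).hom ≫ π = π) ∧
      (∀ S : Finset X₁, ∃ U : X₁.Opens, IsAffineOpen U ∧ (↑S : Set X₁) ⊆ U) ∧
      (∀ a : X₁.functionField, (∀ g : G, RatFn.functionFieldMap (ρ g).hom a = a) →
        ∃ n : ℕ, a ^ ringExpChar X.functionField ^ n ∈ Set.range (RatFn.functionFieldMap π))) :
    ∃ (X' X₁ : Scheme.{0}) (q : X' ⟶ X₁) (φ : X₁ ⟶ X) (G : Type) (_ : Group G) (_ : Finite G)
        (ρ : G →* Aut X'), IsSeparated (φ ≫ f) ∧ LocallyOfFiniteType (φ ≫ f) ∧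
        QuasiCompact (φ ≫ f) ∧ IsIntegral X₁ ∧ IsIntegral X' ∧ Scheme.IsRegular X' ∧ IsFinite q ∧
        Function.Surjective q.base ∧ (∃ U : X₁.Opens, Dense (U : Set X₁) ∧ Etale (q ∣_ U)) ∧
        (∀ g : G, (ρ g).hom ≫ q = q) ∧ (∀ x y : X', q.base x = q.base y → ∃ g : G,
          (ρ g).hom.base x = y) ∧ IsProper φ ∧ Function.Surjective φ.base ∧
        ∃ V : X.Opens, Dense (V : Set X) ∧ IsFinite (φ ∣_ V) ∧ UniversallyInjective (φ ∣_ V) := by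
  -- adapted from `Theorems/WildQuotientsGaloisQuotientAlteration.lean`
  -- (`galoisQuotientAlteration_of_deJong1997`, stmt-16323), with the de Jong hypothesis localised
  -- at `(k, X)`
  classical
  haveI : Fact p.Prime := ⟨hp⟩
  obtain ⟨G, _, _, X', _, ρ, π, _, hπ, hreg, hρinj, hinv, hfinaff, hd⟩ := hdJ
  haveI : Fintype G := Fintype.ofFinite G
  haveI := hπ.isProper
  haveI : Surjective π := hπ.surjective
  haveI : X.IsSeparated := ⟨by rw [← terminal.comp_from f]; infer_instance⟩
  -- the action over `Spec k` and the covering by `G`-stable affine opens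
  let r : X' ⟶ Spec (.of k) := π ≫ f
  let ρA : ActionOver r G := ⟨ρ, fun g => by rw [← Category.assoc, hinv g]⟩
  haveI : IsSeparated r := inferInstanceAs (IsSeparated (π ≫ f))
  haveI : LocallyOfFiniteType r := inferInstanceAs (LocallyOfFiniteType (π ≫ f))
  haveI : QuasiCompact r := inferInstanceAs (QuasiCompact (π ≫ f))
  haveI : X'.IsSeparated := ⟨by rw [← terminal.comp_from r]; infer_instance⟩
  have hcov : ∀ x : X', ∃ O : ρA.StableAffineOpens, x ∈ O.1 := by
    intro x
    obtain ⟨U, hU, hS⟩ := hfinaff (Finset.univ.image fun g : G => (ρ g).hom x)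
    obtain ⟨O, hx, -⟩ := ρA.exists_stableAffineOpen_le_of_orbit x U hU fun g => hS (by
      simp only [Finset.coe_image, Finset.coe_univ, Set.image_univ, Set.mem_range]
      exact ⟨g, rfl⟩)
    exact ⟨O, hx⟩
  -- the quotient `X₁ := X'/G`, `q : X' → X₁`, `φ : X₁ → X`
  have hinv' : ∀ g : G, (ρA.aut g).hom ≫ π = π := hinv
  let q : X' ⟶ ρA.glued := ρA.gluedMk hcov
  let φ : ρA.glued ⟶ X := ρA.gluedDesc π hinv'
  have hqφ : q ≫ φ = π := ρA.gluedMk_gluedDesc hcov π hinv'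
  have hφf : φ ≫ f = ρA.gluedDesc r ρA.aut_comp :=
    ρA.glued_hom_ext hcov (by rw [ρA.gluedMk_gluedDesc_assoc, ρA.gluedMk_gluedDesc])
  haveI : IsIntegral ρA.glued := ρA.isIntegral_glued hcov
  haveI : IsProper φ := ρA.isProper_gluedDesc hcov π hinv' f rfl
  haveI : Surjective φ := ρA.surjective_gluedDesc hcov π hinv'
  haveI : IsFinite q := ρA.isFinite_gluedMk hcov
  haveI : IsSeparated φ := inferInstance
  -- characteristic `p` of `K(X)`
  haveI : CharP X.functionField p := charP_functionField_of_over f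
  haveI : ExpChar X.functionField p := ExpChar.prime hp
  refine ⟨X', ρA.glued, q, φ, G, inferInstance, inferInstance, ρ, ?_, ?_, ?_, inferInstance,
    inferInstance, hreg, inferInstance, ρA.gluedMk_surjective hcov, ?_, ρA.aut_hom_gluedMk hcov,
    fun x y hxy => ρA.exists_aut_apply_eq_of_gluedMk_eq hcov hxy, inferInstance,
    Scheme.Hom.surjective φ, ?_⟩
  · -- separated over `k`
    infer_instance
  · -- locally of finite type over `k` (E. Noether)
    rw [hφf]; exact ρA.locallyOfFiniteType_gluedDesc_base
  · -- quasi-compact over `k`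
    rw [hφf]; exact ρA.quasiCompact_gluedDesc_base hcov
  · -- `q` is étale over a dense open: the action is faithful on `K(X')`
    have hfaith : ∀ g : G, g ≠ 1 → RatFn.functionFieldMap (ρA.aut g).hom ≠ RingHom.id _ :=
      ρA.functionFieldMap_ne_id_of_injective hρinj
    obtain ⟨U, hUne, hU⟩ := ρA.exists_etale_morphismRestrict_gluedMk hcov hfaith
    exact ⟨U, U.isOpen.dense hUne, hU⟩
  · -- `φ` is finite and universally injective over a dense open
    -- (1) finite over a neighbourhood of the generic point `η`: the fibre of `φ` over `η` is finite
    obtain ⟨U₀, hU₀ne, hU₀fin⟩ := hπ.exists_isFinite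
    haveI := hU₀fin
    have hη₀ : genericPoint X ∈ U₀ :=
      ((genericPoint_spec X).mem_open_set_iff U₀.isOpen).mpr (by simpa using hU₀ne)
    have hfib : (φ ⁻¹' {genericPoint X}).Finite := by
      refine ((finite_preimage_singleton_of_isFinite_morphismRestrict π U₀ hη₀).image q).subset ?_
      intro y hy
      obtain ⟨x, rfl⟩ := ρA.gluedMk_surjective hcov y
      refine ⟨x, ?_, rfl⟩
      change π x = genericPoint X
      rw [← hqφ]
      exact hy
    obtain ⟨V₀, hηV₀, hV₀fin⟩ :=
      exists_isFinite_morphismRestrict_of_finite_preimage_singleton φ (genericPoint X) hfib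
    obtain ⟨V₁, hV₁aff, hηV₁, hV₁V₀⟩ := exists_isAffineOpen_mem_and_subset hηV₀
    haveI : IsFinite (φ ∣_ V₁) := morphismRestrict_of_le φ (fun x hx => hV₁V₀ hx) hV₀fin
    -- (2) `K(X₁)/K(X)` is purely inseparable: `K(X₁) ⊆ K(X')^G` via `q♯`, and (d)
    have hpi : ∀ b : (ρA.glued).functionField, ∃ (n : ℕ) (c : X.functionField),
        b ^ p ^ n = RatFn.functionFieldMap φ c := by
      intro b
      have hfix : ∀ g : G, RatFn.functionFieldMap (ρ g).hom (RatFn.functionFieldMap q b) =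
          RatFn.functionFieldMap q b := by
        intro g
        have key : ∀ (q' : X' ⟶ ρA.glued) [IsDominant q'], q' = q →
            RatFn.functionFieldMap q' = RatFn.functionFieldMap q := by
          rintro _ _ rfl; rfl
        have e : RatFn.functionFieldMap ((ρ g).hom ≫ q) = (RatFn.functionFieldMap (ρ g).hom).comp
            (RatFn.functionFieldMap q) := RatFn.functionFieldMap_comp q (ρ g).hom
        rw [← RingHom.comp_apply, ← e, key ((ρ g).hom ≫ q) (ρA.aut_hom_gluedMk hcov g)]
      obtain ⟨n, hn⟩ := hd (RatFn.functionFieldMap q b) hfix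
      rw [ringExpChar.eq X.functionField p] at hn
      obtain ⟨c, hc⟩ := hn
      refine ⟨n, c, ?_⟩
      apply (RatFn.functionFieldMap q).injective
      have key : ∀ (π' : X' ⟶ X) [IsDominant π'], π' = π →
          RatFn.functionFieldMap π' = RatFn.functionFieldMap π := by
        rintro _ _ rfl; rfl
      rw [map_pow, ← hc, ← key (q ≫ φ) hqφ, RatFn.functionFieldMap_comp φ q, RingHom.comp_apply]
    -- (3) radicial over a smaller open
    obtain ⟨V, hηV, -, hVfin, hVui⟩ :=
      exists_isFinite_universallyInjective_morphismRestrict φ hp hV₁aff hηV₁ hpi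
    exact ⟨V, V.isOpen.dense ⟨_, hηV⟩, hVfin, hVui⟩

/-! ## Glue 2: composition with `WQ_p` at a perfect field, for normal projective varieties -/

/-- **De Jong's reduction at a prime `p`, compositional half, squeezed**: Galois-type quotient
presentations of normal projective varieties over perfect fields of characteristic `p` plus `WQ_p`
give purely inseparable regular alterations of those varieties (resolve `X₁` by `WQ_p` and compose
with `φ`; de Jong 1996, 2.20). [cite: DeJong1996, 2.20] -/
theorem pialtPerfectNormalProjectiveAt_of_galoisQuotientAlterationAt {p : ℕ}
    (hGQA : ∀ (k : Type) [Field k] [CharP k p] [PerfectField k] (X : Scheme.{0})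
      (f : X ⟶ Spec (.of k)), IsSeparated f → LocallyOfFiniteType f → QuasiCompact f →
      IsIntegral X → (∀ x : X, IsIntegrallyClosed (X.presheaf.stalk x)) →
      Motives.IsProjectiveOver (Over.mk f) →
      ∃ (X' X₁ : Scheme.{0}) (q : X' ⟶ X₁) (φ : X₁ ⟶ X) (G : Type) (_ : Group G) (_ : Finite G)
        (ρ : G →* Aut X'), IsSeparated (φ ≫ f) ∧ LocallyOfFiniteType (φ ≫ f) ∧
        QuasiCompact (φ ≫ f) ∧ IsIntegral X₁ ∧ IsIntegral X' ∧ Scheme.IsRegular X' ∧ IsFinite q ∧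
        Function.Surjective q.base ∧ (∃ U : X₁.Opens, Dense (U : Set X₁) ∧ Etale (q ∣_ U)) ∧
        (∀ g : G, (ρ g).hom ≫ q = q) ∧ (∀ x y : X', q.base x = q.base y → ∃ g : G,
          (ρ g).hom.base x = y) ∧ IsProper φ ∧ Function.Surjective φ.base ∧
        ∃ V : X.Opens, Dense (V : Set X) ∧ IsFinite (φ ∣_ V) ∧ UniversallyInjective (φ ∣_ V))
    (hWQ : ∀ (k : Type) [Field k] [CharP k p] (X' X₁ : Scheme.{0}) (f : X₁ ⟶ Spec (.of k))
      (q : X' ⟶ X₁) (G : Type) [Group G] [Finite G] (ρ : G →* Aut X'),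
      IsSeparated f → LocallyOfFiniteType f → QuasiCompact f → IsIntegral X₁ → IsIntegral X' →
      Scheme.IsRegular X' → IsFinite q → Function.Surjective q.base →
      (∃ U : X₁.Opens, Dense (U : Set X₁) ∧ Etale (q ∣_ U)) → (∀ g : G, (ρ g).hom ≫ q = q) →
      (∀ x y : X', q.base x = q.base y → ∃ g : G, (ρ g).hom.base x = y) →
      Scheme.HasResolution X₁)
    (k : Type) [Field k] [CharP k p] [PerfectField k] (X : Scheme.{0}) (f : X ⟶ Spec (.of k))
    (hi : IsIntegral X) (hproj : Motives.IsProjectiveOver (Over.mk f))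
    (hN : ∀ x : X, IsIntegrallyClosed (X.presheaf.stalk x)) :
    ∃ (X' : Scheme.{0}) (g : X' ⟶ X), IsProper g ∧ IsIntegral X' ∧ Scheme.IsRegular X' ∧
      Function.Surjective g.base ∧
      ∃ U : X.Opens, Dense (U : Set X) ∧ IsFinite (g ∣_ U) ∧ UniversallyInjective (g ∣_ U) := by
  haveI := hi
  haveI : IsProper f := Motives.IsProjectiveOver.isProper hproj
  obtain ⟨X', X₁, q, φ, G, _, _, ρ, hs₁, hl₁, hq₁, hi₁, hi', hreg', hfin, hsurj, hU, hinv, horb,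
    hφp, hφs, V, hV, hVfin, hVui⟩ :=
    hGQA k X f inferInstance inferInstance inferInstance hi hN hproj
  -- resolve the quotient `X₁` by `WQ_p`
  have hres : Scheme.HasResolution X₁ :=
    hWQ k X' X₁ (φ ≫ f) q G ρ hs₁ hl₁ hq₁ hi₁ hi' hreg' hfin hsurj hU hinv horb
  obtain ⟨X₂, π, hπ⟩ := hres
  haveI : IsIntegral X₁ := hi₁
  -- `φ` is a purely inseparable alteration, and so is the resolution `π`; compose
  have hφ : IsPurelyInseparableAlteration φ :=
    { isIntegral := hi₁
      isProper := hφp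
      isDominant := ⟨hφs.denseRange⟩
      exists_isFinite_universallyInjective := ⟨V, hV.nonempty, hVfin, hVui⟩ }
  have hcomp : IsPurelyInseparableAlteration (π ≫ φ) := hπ.isPurelyInseparableAlteration.comp hφ
  haveI := hcomp.isProper
  haveI := hcomp.surjective
  obtain ⟨W, hW, hWfin, hWui⟩ := hcomp.exists_dense
  exact ⟨X₂, π ≫ φ, inferInstance, hcomp.isIntegral, hπ.isRegular, (π ≫ φ).surjective,
    W, hW, hWfin, hWui⟩

/-! ## Glue 3: the frame — de Jong is needed only for normal projective `X` over perfect fields -/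

/-- **Frame at a prime `p`** (ideator 2, re-proved from tree theorems): `ResolutionInChar p` follows
from `PICover_p` as soon as one has purely inseparable regular alterations of NORMAL PROJECTIVE
varieties over PERFECT fields of characteristic `p` — perfect closure + finite-level descent
(`stub_pialtOfPerfect`), Chow + normalisation (`pialtConclusion_of_forall_normal_isProjectiveOver`),
Theorem B (`hasResolution_of_thesis`, every field) and reduced → integral
(`DescentReducedToIntegral_holds`). [folklore] -/
theorem resolutionInChar_of_pialtPerfectNormalProjectiveAt_of_picoverAt (p : ℕ) (hp : p.Prime)
    (hPN : ∀ (K : Type) [Field K] [CharP K p] [PerfectField K] (X : Scheme.{0})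
      (f : X ⟶ Spec (.of K)), IsIntegral X → Motives.IsProjectiveOver (Over.mk f) →
      (∀ x : X, IsIntegrallyClosed (X.presheaf.stalk x)) →
        ∃ (X' : Scheme.{0}) (g : X' ⟶ X), IsProper g ∧ IsIntegral X' ∧ Scheme.IsRegular X' ∧
          Function.Surjective g.base ∧ ∃ U : X.Opens, Dense (U : Set X) ∧ IsFinite (g ∣_ U) ∧
            UniversallyInjective (g ∣_ U))
    (hPC : ∀ (k : Type) [Field k] [CharP k p] (Y X : Scheme.{0}) (f : Y ⟶ Spec (.of k))
      (g : X ⟶ Y), IsSeparated f → LocallyOfFiniteType f → QuasiCompact f → IsIntegral Y →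
      Scheme.IsRegular Y → IsIntegral X → IsFinite g → UniversallyInjective g →
      Function.Surjective g.base → Scheme.HasResolution X) :
    ResolutionInChar.{0} p := by
  haveI : Fact p.Prime := ⟨hp⟩
  have hPI : ∀ (k : Type) [Field k] [CharP k p] (X : Scheme.{0}) (f : X ⟶ Spec (.of k)),
      IsSeparated f → LocallyOfFiniteType f → QuasiCompact f → IsIntegral X →
      ∃ (X' : Scheme.{0}) (g : X' ⟶ X), IsProper g ∧ IsIntegral X' ∧ Scheme.IsRegular X' ∧
        Function.Surjective g.base ∧ ∃ U : X.Opens, Dense (U : Set X) ∧ IsFinite (g ∣_ U) ∧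
        UniversallyInjective (g ∣_ U) := by
    intro k _ _ X f hs hl hq hi
    haveI := hs; haveI := hl; haveI := hq; haveI := hi
    refine PalterationThesis.PerfectTransfer.stub_pialtOfPerfect p k (fun Y g h1 h2 h3 h4 => ?_) X f
    haveI := h1; haveI := h2; haveI := h3; haveI := h4
    exact pialtConclusion_of_forall_normal_isProjectiveOver g
      (fun X' f' hi' hproj hN => hPN (PerfectClosure k p) X' f' hi' hproj hN)
  intro k _ _ X f hs hl hq hred
  exact Theses.PAlteration.DescentReducedToIntegral_holds k (fun Y g h1 h2 h3 h4 => by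
      haveI := h1; haveI := h2; haveI := h3; haveI := h4
      exact hasResolution_of_thesis p hPI hPC g) X f hs hl hq hred

/-! ## The squeezed reduction at a prime -/

/-- **The de Jong reduction at a prime `p`, squeezed**: if every NORMAL PROJECTIVE integral
variety over every PERFECT field of characteristic `p` admits de Jong's Galois alteration
`(X₁, G, π)` (regular integral quasi-projective source, faithful `G`, `K(X) ⊂ K(X₁)^G` purely
inseparable — de Jong 1997, Thm. 5.13 / Cor. 5.15), then `WQ_p → PICover_p → ResolutionInChar p`.
[cite: DeJong1997, Thm. 5.13, Cor. 5.15] -/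
theorem resolutionInChar_of_galoisAlterationPerfectAt (p : ℕ) (hp : p.Prime)
    (hdJ : ∀ (k : Type) [Field k] [CharP k p] [PerfectField k]
      (X : Scheme.{0}) [IsIntegral X] (f : X ⟶ Spec (.of k)),
      IsSeparated f → LocallyOfFiniteType f → QuasiCompact f →
      (∀ x : X, IsIntegrallyClosed (X.presheaf.stalk x)) → Motives.IsProjectiveOver (Over.mk f) →
      ∃ (G : Type) (_ : Group G) (_ : Finite G) (X₁ : Scheme.{0}) (_ : IsIntegral X₁)
        (ρ : G →* Aut X₁) (π : X₁ ⟶ X) (_ : IsDominant π),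
        IsAlteration π ∧ Scheme.IsRegular X₁ ∧ Function.Injective ρ ∧
        (∀ g : G, (ρ g).hom ≫ π = π) ∧
        (∀ S : Finset X₁, ∃ U : X₁.Opens, IsAffineOpen U ∧ (↑S : Set X₁) ⊆ U) ∧
        (∀ a : X₁.functionField, (∀ g : G, RatFn.functionFieldMap (ρ g).hom a = a) →
          ∃ n : ℕ, a ^ ringExpChar X.functionField ^ n ∈ Set.range (RatFn.functionFieldMap π)))
    (hWQ : ∀ (k : Type) [Field k] [CharP k p] (X' X₁ : Scheme.{0}) (f : X₁ ⟶ Spec (.of k))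
      (q : X' ⟶ X₁) (G : Type) [Group G] [Finite G] (ρ : G →* Aut X'),
      IsSeparated f → LocallyOfFiniteType f → QuasiCompact f → IsIntegral X₁ → IsIntegral X' →
      Scheme.IsRegular X' → IsFinite q → Function.Surjective q.base →
      (∃ U : X₁.Opens, Dense (U : Set X₁) ∧ Etale (q ∣_ U)) → (∀ g : G, (ρ g).hom ≫ q = q) →
      (∀ x y : X', q.base x = q.base y → ∃ g : G, (ρ g).hom.base x = y) →
      Scheme.HasResolution X₁)
    (hPC : ∀ (k : Type) [Field k] [CharP k p] (Y X : Scheme.{0}) (f : Y ⟶ Spec (.of k))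
      (g : X ⟶ Y), IsSeparated f → LocallyOfFiniteType f → QuasiCompact f → IsIntegral Y →
      Scheme.IsRegular Y → IsIntegral X → IsFinite g → UniversallyInjective g →
      Function.Surjective g.base → Scheme.HasResolution X) :
    ResolutionInChar.{0} p := by
  refine resolutionInChar_of_pialtPerfectNormalProjectiveAt_of_picoverAt p hp ?_ hPC
  refine pialtPerfectNormalProjectiveAt_of_galoisQuotientAlterationAt (p := p) ?_ hWQ
  intro k _ _ _ X f hs hl hq hi hN hproj
  haveI := hs; haveI := hl; haveI := hq; haveI := hi
  exact galoisQuotientAlterationAt_of_deJong hp X f (hdJ k X f hs hl hq hN hproj)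

/-! ## The squeezed conditional closing theorem -/

/-- **`SummitReduction` from de Jong's Galois alteration theorem for normal projective varieties
over perfect fields** (the perfect squeeze of `summitReduction_of_deJong1997`): if for every prime
`p`, every perfect field `k` of characteristic `p` and every normal projective integral `X/k` there
is a Galois alteration `(X₁, G, π)` with `X₁` regular integral and quasi-projective (finite subsets
in affine opens), `G` faithful and `K(X) ⊂ K(X₁)^G` purely inseparable (de Jong 1997, Thm. 5.13 /
Cor. 5.15; de Jong 1996, Thm. 7.3; Abramovich–Oort 2000, Thm. 2.8), then
`WildQuotients.SummitReduction` holds. [cite: DeJong1997, Thm. 5.13, Cor. 5.15] -/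
theorem summitReduction_of_forall_perfectField_galoisAlteration : (∀ (p : ℕ), p.Prime → ∀ (k : Type) [Field k] [CharP k p] [PerfectField k] (X : AlgebraicGeometry.Scheme.{0}) [AlgebraicGeometry.IsIntegral X] (f : X ⟶ AlgebraicGeometry.Spec (.of k)), AlgebraicGeometry.IsSeparated f → AlgebraicGeometry.LocallyOfFiniteType f → AlgebraicGeometry.QuasiCompact f → (∀ x : X, IsIntegrallyClosed (X.presheaf.stalk x)) → Literature.AlgebraicGeometry.Motives.IsProjectiveOver (CategoryTheory.Over.mk f) → ∃ (G : Type) (_ : Group G) (_ : Finite G) (X₁ : AlgebraicGeometry.Scheme.{0}) (_ : AlgebraicGeometry.IsIntegral X₁) (ρ : G →* CategoryTheory.Aut X₁) (π : X₁ ⟶ X) (_ : AlgebraicGeometry.IsDominant π), Literature.AlgebraicGeometry.Resolution.IsAlteration π ∧ Literature.AlgebraicGeometry.Resolution.Scheme.IsRegular X₁ ∧ Function.Injective ρ ∧ (∀ g : G, CategoryTheory.CategoryStruct.comp (ρ g).hom π = π) ∧ (∀ S : Finset X₁, ∃ U : X₁.Opens, AlgebraicGeometry.IsAffineOpen U ∧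 (↑S : Set X₁) ⊆ U) ∧ (∀ a : X₁.functionField, (∀ g : G, Literature.AlgebraicGeometry.Motives.RatFn.functionFieldMap (ρ g).hom a = a) → ∃ n : ℕ, a ^ ringExpChar X.functionField ^ n ∈ Set.range (Literature.AlgebraicGeometry.Motives.RatFn.functionFieldMap π))) → Summit.ResolutionOfSingularities.ResolutionOfSingularities.Theses.WildQuotients.SummitReduction :=
  fun hdJ p hp hWQ hPC =>
    resolutionInChar_of_galoisAlterationPerfectAt p hp (fun k _ _ _ X _ f => hdJ p hp k X f) hWQ hPC

end Summit.ResolutionOfSingularities.ResolutionOfSingularities.Theorems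

end
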